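import Mathlib
import HarnessLib
import Summits.AnomalousDissipation.AnomalousDissipation.Theses.DyadicWallCascade
import Summits.AnomalousDissipation.AnomalousDissipation.Theorems.HalfSpaceHierarchy.Negative.Reversible

/-!
# Stub `stub_zeroStressOfHalfTurn` of line `SketchIdeator4` — crux stmt-AnomalousDissipation-17917
  (`DyadicWallCascade.ViscousContinuation`)

Registered stub of the zero-stress-split skeleton (`Cruxes/ViscousContinuation/Lines/SketchIdeator4.lean`):
the symmetry discharge of the zero-stress clause.  A field `V` on the upper half-space, continuous
(here: smooth) there, `1`-periodic in `x, y` on the band `1 ≤ z ≤ 2`, and COVARIANT under the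
half-turn about the vertical axis, `V (-x, -y, z) = (-V₀, -V₁, V₂)(x, y, z)`, has ZERO Reynolds
stress on the unit square of the plane `z = 1`:
`∫_{[0,1]²} V₂V₀(q, 1) dq = ∫_{[0,1]²} V₂V₁(q, 1) dq = 0`.

Proof: on the plane `z = 1` the densities `V₂V₀`, `V₂V₁` are continuous, `ℤ²`-periodic and ODD under
`q ↦ -q` (`V₂` is even, `V₀, V₁` are odd), so the tree lemma
`HalfSpaceHierarchyNegative.setIntegral_unitSq_eq_zero_of_odd_periodic` (Negative/Reversible.lean)
applies.  This is the "p4m gives zero stress for free" remark of PLANNER-FINDING-r2-k4 §4 (R1) as a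
theorem; the half-turn `C₂` alone suffices.  (Contrast: half-turn REVERSIBILITY `V ∘ R = -R V` is
refuted for hierarchies, `not_halfTurnReversibleHalfSpaceHierarchy`; covariance is not.)
-/

-- `Summit.<Summit>.<Problem>`: single-conjunct summit; the duplicate namespace is mandated.
set_option linter.dupNamespace false

noncomputable section

namespace Summit.AnomalousDissipation.AnomalousDissipation.Theorems

open MeasureTheory
open Summit.AnomalousDissipation.AnomalousDissipation.Theses.DyadicWallCascade
open HalfSpaceHierarchyNegative

/-- One component: for a horizontal index `i ≠ 2`, a band-periodic field on the upper half-space,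
continuous there and covariant under the half-turn `(x, y, z) ↦ (-x, -y, z)`, has
`∫_{[0,1]²} V₂Vᵢ(q, 1) dq = 0` (odd, `ℤ²`-periodic, continuous density). [folklore] -/
theorem zeroStress_component_of_halfTurn
    (V : EuclideanSpace ℝ (Fin 3) → EuclideanSpace ℝ (Fin 3)) (i : Fin 3) (hi : i ≠ 2)
    (hVc : ContinuousOn V {X : EuclideanSpace ℝ (Fin 3) | 0 < X 2})
    (hper : ∀ X : EuclideanSpace ℝ (Fin 3), 1 ≤ X 2 → X 2 ≤ 2 →
      V (X + EuclideanSpace.single 0 (1 : ℝ)) = V X ∧ V (X + EuclideanSpace.single 1 (1 : ℝ)) = V X)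
    (hsym : ∀ X : EuclideanSpace ℝ (Fin 3), 0 < X 2 →
      V (!₂[-(X 0), -(X 1), X 2]) = !₂[-((V X) 0), -((V X) 1), (V X) 2]) :
    ∫ q in Set.Icc (0 : ℝ) 1 ×ˢ Set.Icc (0 : ℝ) 1,
      (V !₂[q.1, q.2, (1 : ℝ)]) 2 * (V !₂[q.1, q.2, (1 : ℝ)]) i = 0 := by
  -- continuity of the density on the plane `z = 1`
  have hptH : ∀ q : ℝ × ℝ, (!₂[q.1, q.2, (1 : ℝ)] : EuclideanSpace ℝ (Fin 3)) ∈
      {X : EuclideanSpace ℝ (Fin 3) | 0 < X 2} := by intro q; simp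
  have hVq : Continuous fun q : ℝ × ℝ => V !₂[q.1, q.2, (1 : ℝ)] :=
    hVc.comp_continuous continuous_pt hptH
  have hV2c : Continuous fun q : ℝ × ℝ => (V !₂[q.1, q.2, (1 : ℝ)]) 2 :=
    (PiLp.continuous_apply 2 (fun _ : Fin 3 => ℝ) (2 : Fin 3)).comp hVq
  have hVic : Continuous fun q : ℝ × ℝ => (V !₂[q.1, q.2, (1 : ℝ)]) i :=
    (PiLp.continuous_apply 2 (fun _ : Fin 3 => ℝ) i).comp hVq
  have hfc : Continuous fun q : ℝ × ℝ => (V !₂[q.1, q.2, (1 : ℝ)]) 2 * (V !₂[q.1, q.2, (1 : ℝ)]) i :=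
    hV2c.mul hVic
  -- the half-turn on the plane
  have hR : ∀ x y : ℝ, (!₂[-((!₂[-x, -y, (1:ℝ)] : EuclideanSpace ℝ (Fin 3)) 0),
      -((!₂[-x, -y, (1:ℝ)] : EuclideanSpace ℝ (Fin 3)) 1), (!₂[-x, -y, (1:ℝ)] : EuclideanSpace ℝ (Fin 3)) 2]
        : EuclideanSpace ℝ (Fin 3)) = !₂[x, y, (1:ℝ)] := by
    intro x y; ext j; fin_cases j <;> simp
  have hpos : ∀ x y : ℝ, (0 : ℝ) < ((!₂[-x, -y, (1:ℝ)] : EuclideanSpace ℝ (Fin 3))) 2 := by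
    intro x y; simp
  have hVsym : ∀ x y : ℝ, V !₂[x, y, (1:ℝ)] =
      !₂[-((V !₂[-x, -y, (1:ℝ)]) 0), -((V !₂[-x, -y, (1:ℝ)]) 1), (V !₂[-x, -y, (1:ℝ)]) 2] := by
    intro x y
    have := hsym !₂[-x, -y, (1:ℝ)] (hpos x y)
    rwa [hR x y] at this
  have hV2 : ∀ x y : ℝ, (V !₂[x, y, (1:ℝ)]) 2 = (V !₂[-x, -y, (1:ℝ)]) 2 := by
    intro x y; rw [hVsym x y]; simp
  have hVi : ∀ x y : ℝ, (V !₂[x, y, (1:ℝ)]) i = -((V !₂[-x, -y, (1:ℝ)]) i) := by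
    intro x y; rw [hVsym x y]
    fin_cases i
    · simp
    · simp
    · exact absurd rfl hi
  -- periodicity on the plane
  have he0 : ∀ x y : ℝ, (!₂[x + 1, y, (1:ℝ)] : EuclideanSpace ℝ (Fin 3))
      = !₂[x, y, (1:ℝ)] + EuclideanSpace.single (0 : Fin 3) (1:ℝ) := by
    intro x y; ext j; fin_cases j <;> simp
  have he1 : ∀ x y : ℝ, (!₂[x, y + 1, (1:ℝ)] : EuclideanSpace ℝ (Fin 3))
      = !₂[x, y, (1:ℝ)] + EuclideanSpace.single (1 : Fin 3) (1:ℝ) := by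
    intro x y; ext j; fin_cases j <;> simp
  have hp2 : ∀ x y : ℝ, ((!₂[x, y, (1:ℝ)] : EuclideanSpace ℝ (Fin 3))) 2 = 1 := by intro x y; simp
  have hperV0 : ∀ x y : ℝ, V !₂[x + 1, y, (1:ℝ)] = V !₂[x, y, (1:ℝ)] := fun x y => by
    rw [he0]; exact (hper _ (by rw [hp2]) (by rw [hp2]; norm_num)).1
  have hperV1 : ∀ x y : ℝ, V !₂[x, y + 1, (1:ℝ)] = V !₂[x, y, (1:ℝ)] := fun x y => by
    rw [he1]; exact (hper _ (by rw [hp2]) (by rw [hp2]; norm_num)).2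
  exact setIntegral_unitSq_eq_zero_of_odd_periodic
    (fun q => (V !₂[q.1, q.2, (1 : ℝ)]) 2 * (V !₂[q.1, q.2, (1 : ℝ)]) i)
    hfc (fun x y => by simp only; rw [hV2 x y, hVi x y]; ring)
    (fun x y => by simp only; rw [hperV0]) (fun x y => by simp only; rw [hperV1])

/-- **Symmetry discharge of the zero-stress clause** (registered stub `stub_zeroStressOfHalfTurn`
of line `SketchIdeator4`, crux stmt-AnomalousDissipation-17917).  A field `V` smooth on the open
upper half-space, `1`-periodic in `x, y` on the band `1 ≤ z ≤ 2` and covariant under the half-turn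
`(x, y, z) ↦ (-x, -y, z)` (i.e. `V (-x, -y, z) = (-V₀, -V₁, V₂)(x, y, z)`) has zero Reynolds stress
on the unit square of the plane `z = 1`: `∫ V₂V₀ = ∫ V₂V₁ = 0` there.  So a half-turn-symmetric
half-space hierarchy is a zero-stress hierarchy (the normalisation forced on the blow-down of any
viscous wall profile, `stub_zeroStress`). [folklore] -/
theorem stub_zeroStressOfHalfTurn :
    ∀ (V : EuclideanSpace ℝ (Fin 3) → EuclideanSpace ℝ (Fin 3)),
      ContDiffOn ℝ ((⊤ : ℕ∞) : WithTop ℕ∞) V {X : EuclideanSpace ℝ (Fin 3) | 0 < X 2} →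
      (∀ X : EuclideanSpace ℝ (Fin 3), 1 ≤ X 2 → X 2 ≤ 2 →
        V (X + EuclideanSpace.single 0 (1 : ℝ)) = V X ∧
          V (X + EuclideanSpace.single 1 (1 : ℝ)) = V X) →
      (∀ X : EuclideanSpace ℝ (Fin 3), 0 < X 2 →
        V (!₂[-(X 0), -(X 1), X 2]) = !₂[-((V X) 0), -((V X) 1), (V X) 2]) →
      (∫ q in Set.Icc (0 : ℝ) 1 ×ˢ Set.Icc (0 : ℝ) 1,
          (V !₂[q.1, q.2, (1 : ℝ)]) 2 * (V !₂[q.1, q.2, (1 : ℝ)]) 0 = 0) ∧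
        (∫ q in Set.Icc (0 : ℝ) 1 ×ˢ Set.Icc (0 : ℝ) 1,
          (V !₂[q.1, q.2, (1 : ℝ)]) 2 * (V !₂[q.1, q.2, (1 : ℝ)]) 1 = 0) := by
  intro V hVs hper hsym
  exact ⟨zeroStress_component_of_halfTurn V 0 (by decide) hVs.continuousOn hper hsym,
    zeroStress_component_of_halfTurn V 1 (by decide) hVs.continuousOn hper hsym⟩

end Summit.AnomalousDissipation.AnomalousDissipation.Theorems

end
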